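import Summits.Ventures.Crystal3D.Bulk.HoleForm
import Summits.Ventures.Crystal3D.Bulk.CapX2BoxW06225
import Summits.Ventures.Crystal3D.Bulk.CapX2BoxW0625
import HarnessLib

/-!
# GAP ladder dictionary, computational rung: GAP(1.245) from the tree's `CapX2.noHole_06225`

HONEST FRAMING. Part of the venture `Summits/Ventures/Crystal3D` (cell `pub-crystal3d`, phase 2, decision
sprint; seat p1, lead g7 RULING #4 (g7) (1)(a)). PURE BOOKKEEPING, companion of `Bulk/GapLadder.lean` (see there for
the dictionary `NoHole (h/2) ⇒ GapTupleDiam h ⇒ TwelveNeighbourGap h`, `Bulk/HoleForm.lean`). COMPUTATIONAL FILE: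
the rung `h = 1.245` comes from `CapX2.noHole_06225 : NoHole 0.6225` (`Bulk/CapX2BoxW06225.lean`, seats typer-bulk +
p1), a tree theorem of COMPUTATIONAL grade — its closure is the three standard axioms plus EXACTLY the 109
`native_decide` axioms of the consumed piece files `CapX2BoxW06225P…/T…` (one compiled S-procedure
tensor-Bernstein evaluation `Bern.checkPos3S` each, discharging (II)(III) of idea-2's certificate
`cert_w6225_d14_dX14_u06225`), and both declarations below INHERIT those 109 axioms. So: **GAP(1.245), TREE
THEOREM, computational grade** (`ρ* < 51.5010716°`). NOT claimed: GAP(1.26); nothing here is kernel-unconditional.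

APPENDED 2026-08-23 (seat p1 g8, same ruling + lead g7 RULING #147/#171 flip): the rung `h = 1.25` from
`CapX2.noHole_0625 : NoHole 0.625` (`Bulk/CapX2BoxW0625.lean`, seat typer-bulk g5), the tree's COMPUTATIONAL discharge
of (II)(III) of idea-2's level-#4 certificate `cert_p625_d14_dX16_u0625` (bundle `5157838bb94b11fc`) by the registered
67-piece cover (one `native_decide` axiom per piece file `CapX2BoxW0625P…/T…`, compiled `Bern.checkPos3Z` /
`Bern.checkPos3S` evaluations); `gapTupleDiam_125` / `twelveNeighbourGap_125` INHERIT exactly those piece axioms and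
nothing else beyond the three standard ones. So: **GAP(1.25), TREE THEOREM, computational grade**
(`ρ* < arccos 0.625 ≤ 51.3178126°`); the KERNEL-grade form of the same rung, modulo (II)(III) as named hypotheses, is
`gapTupleDiam_125_of_certW0625` in `Bulk/GapLadder.lean`. Still NOT claimed: GAP(1.26).
-/

noncomputable section

namespace Summit.Ventures.Crystal3D

/-- **GAP(1.245), fourteen-ball form — computational grade** (inherits the 109 `native_decide` axioms of
`CapX2.noHole_06225`). -/
theorem gapTupleDiam_1245 : GapTupleDiam 1.245 :=
  gapTupleDiam_of_noHole (h := 1.245)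
    (by rw [show (1.245 : ℝ) / 2 = 0.6225 by norm_num]; exact CapX2.noHole_06225)

/-- **GAP(1.245), twelve-neighbour form — computational grade**: every twelve-coordinated ball of a finite unit-ball
packing of `ℝ³` has every other centre at distance `1` or `≥ 1.245` (standard axioms + the 109 piece natives). -/
theorem twelveNeighbourGap_1245 : TwelveNeighbourGap 1.245 :=
  twelveNeighbourGap_of_gapTupleDiam gapTupleDiam_1245

/-- **GAP(1.25), fourteen-ball form — computational grade**: from the tree's `CapX2.noHole_0625 : NoHole 0.625`
(`Bulk/CapX2BoxW0625.lean`); inherits exactly the `native_decide` piece axioms of the W0625 cover (one per consumed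
piece file) and is otherwise standard. The kernel-grade form modulo (II)(III) is `gapTupleDiam_125_of_certW0625`. -/
theorem gapTupleDiam_125 : GapTupleDiam 1.25 :=
  gapTupleDiam_of_noHole (h := 1.25)
    (by rw [show (1.25 : ℝ) / 2 = 0.625 by norm_num]; exact CapX2.noHole_0625)

/-- **GAP(1.25), twelve-neighbour form — computational grade**: every twelve-coordinated ball of a finite unit-ball
packing of `ℝ³` has every other centre at distance `1` or `≥ 1.25` (standard axioms + the W0625 piece natives). -/
theorem twelveNeighbourGap_125 : TwelveNeighbourGap 1.25 :=
  twelveNeighbourGap_of_gapTupleDiam gapTupleDiam_125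

end Summit.Ventures.Crystal3D

end
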